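import Mathlib.Algebra.Group.Int.Even
import Mathlib.Algebra.Order.Group.Int
import Mathlib.Tactic.Linarith
import HarnessLib

/-!
# Venture HSemireg — a closed walk through copies of ONE letter never leaves one position

Elementary bookkeeping behind the «per-position form» of LEMMA ST used by the computation cell
`pub-hsemireg` (W1 sub-lead seat w1-cx-1 g7, cell bus HOME/INBOX l.16349; card
`widen/W1/cx1/W1-CX-MASSEY3.md` §5octies (2)).  In the potential graph of a parity-pure one-sided
twisted complex every arrow raises the offset (position) by AT MOST ONE, and two copies of the same
letter sit at offsets of the same parity, i.e. their offsets differ by an EVEN integer.  Hence along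
a walk that visits only copies of one letter the offsets `f 0, f 1, …, f n` satisfy
`f (i+1) ≤ f i + 1` with `f (i+1) - f i` even, so they never increase; if the walk is closed
(`f n = f 0`) they are all equal.  Consequence used by the cell: the «pure-cluster» words that the
unit-spread deciders discard are confined to the copies of the letter at ONE position, so the
supertrace over that single cluster already removes them (the kill-fold convention (L)).

* `nonpos_of_even_of_le_one` — an even integer `≤ 1` is `≤ 0`;
* `offsets_antitone` — even-valued offsets rising by at most one per step never increase;
* `offsets_const_of_closed` — **a closed such walk stays at one offset**;
* `offsets_const_of_closed'` — the same with the shift-invariant hypothesis «all differences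
  `f i - f 0` even» (the form the potential graph gives: copies of one letter sit at offsets of one
  parity; red-w-2's precision P-L-3), reduced to the previous statement applied to `i ↦ f i - f 0`.

HONEST FRAMING. Integer sequences only; the Lean index of one bookkeeping step of a
NECESSARY-condition sieve.  No sheaf, complex, abelian variety or semiregularity map appears;
nothing here says that HC, HC_CM or HC_AV holds, and nothing here is a new case of anything.
-/

namespace Summit.Ventures.HSemireg

namespace ClusterConfinement

/-- An even integer that is at most `1` is at most `0`. -/
theorem nonpos_of_even_of_le_one {d : ℤ} (hev : Even d) (hle : d ≤ 1) : d ≤ 0 := by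
  obtain ⟨k, hk⟩ := hev
  omega

/-- Offsets `f 0, …, f n` along a walk through copies of one letter: each step raises the offset by
at most one (`f (i+1) ≤ f i + 1`) and all offsets are even; then the offsets never increase:
`f j ≤ f i` whenever `i ≤ j ≤ n`. -/
theorem offsets_antitone (f : ℕ → ℤ) (n : ℕ)
    (hstep : ∀ i < n, f (i + 1) ≤ f i + 1) (hev : ∀ i ≤ n, Even (f i)) :
    ∀ i j : ℕ, i ≤ j → j ≤ n → f j ≤ f i := by
  intro i j hij hjn
  induction j with
  | zero =>
    have hi : i = 0 := Nat.le_zero.mp hij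
    subst hi
    exact le_refl _
  | succ j ih =>
    rcases Nat.lt_or_ge j i with hlt | hge
    · -- then i = j + 1
      have : i = j + 1 := le_antisymm hij hlt
      subst this
      exact le_refl _
    · have hjn' : j ≤ n := Nat.le_of_succ_le hjn
      have hprev : f j ≤ f i := ih hge hjn'
      have hjlt : j < n := Nat.lt_of_succ_le hjn
      have hdiff_even : Even (f (j + 1) - f j) := Int.even_sub.mpr
        ⟨fun _ => hev j hjn', fun _ => hev (j + 1) hjn⟩
      have hdiff_le : f (j + 1) - f j ≤ 1 := by linarith [hstep j hjlt]
      have hdiff_nonpos := nonpos_of_even_of_le_one hdiff_even hdiff_le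
      linarith

/-- **Cluster confinement.** If, in addition, the walk is closed (`f n = f 0`), every offset equals
the starting one: a closed walk through copies of one letter never leaves one position. -/
theorem offsets_const_of_closed (f : ℕ → ℤ) (n : ℕ)
    (hstep : ∀ i < n, f (i + 1) ≤ f i + 1) (hev : ∀ i ≤ n, Even (f i)) (hclosed : f n = f 0) :
    ∀ i ≤ n, f i = f 0 := by
  intro i hin
  have h1 : f i ≤ f 0 := offsets_antitone f n hstep hev 0 i (Nat.zero_le i) hin
  have h2 : f n ≤ f i := offsets_antitone f n hstep hev i n hin (le_refl n)
  rw [hclosed] at h2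
  exact le_antisymm h1 h2

/-- **Cluster confinement, shift-invariant form.** Steps rise by at most one, all DIFFERENCES
`f i - f 0` are even (copies of one letter sit at offsets of a single parity), and the walk is closed;
then every offset equals the starting one. -/
theorem offsets_const_of_closed' (f : ℕ → ℤ) (n : ℕ)
    (hstep : ∀ i < n, f (i + 1) ≤ f i + 1) (hev : ∀ i ≤ n, Even (f i - f 0))
    (hclosed : f n = f 0) : ∀ i ≤ n, f i = f 0 := by
  intro i hin
  have hstep' : ∀ j < n, (f (j + 1) - f 0) ≤ (f j - f 0) + 1 := fun j hj => by
    linarith [hstep j hj]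
  have hclosed' : f n - f 0 = f 0 - f 0 := by rw [hclosed]
  have h := offsets_const_of_closed (fun j => f j - f 0) n hstep' hev hclosed' i hin
  -- h : f i - f 0 = f 0 - f 0
  have : f i - f 0 = 0 := by simpa using h
  linarith

end ClusterConfinement

end Summit.Ventures.HSemireg
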